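import Summits.ResolutionOfSingularities.ResolutionOfSingularities.Theorems.FrobeniusLadderFInjectiveMacaulayficationF108ToricRel
import Summits.ResolutionOfSingularities.ResolutionOfSingularities.Theorems.FrobeniusLadderFInjectiveMacaulayficationF108ToricBuild
import Summits.ResolutionOfSingularities.ResolutionOfSingularities.Theorems.FrobeniusLadderFInjectiveMacaulayficationF108ToricTables
import Summits.ResolutionOfSingularities.ResolutionOfSingularities.Theorems.FrobeniusLadderFInjectiveMacaulayficationMonomialFloorClassRow

/-!
# [OURS · L1 W4.5a] ★ `F108ConsumableRel_holds`: the RELATIVE open-obligation node `MonomialFloorClassRow.F108ConsumableRel k n`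
# holds for every field `k` and every `n`

THE TORIC RESOLUTION OF THE NEWTON FAN OF A CONVENIENT POLYNOMIAL RELATIVE TO AN ARBITRARY `𝔪`-PRIMARY MONOMIAL FLOOR `(x^B)`, in the
consumer's fan-table currency (✓ p685336 `…MonomialFloorClassRow`, §1), proved in the kernel on res-L1-toric-fan g0's edge-star engine
(✓ `…F108ToricCones/Star/StarSC/Stage/Build/MW/Tables/Poly`, ✓ p687854 `F108Consumable_holds`) and the relative step `…F108ToricRel`
(sum sets, the `B`-shifted state, the product formula); seat res-L1-toric-fan g2.

METHOD. Run ✓ `exists_inv_good_convenient` on the pointwise SUM `E + B` (`E = supp f`; both carry a pure power of every variable, hence so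
does the sum): every cone of the resulting state `S` has a common minimiser `e₀` over `E` and `b_d` over `B`.  Shift every vertex by `b_d`
(`inv_image_shift`: the shifted cones are a state again).  Tables: `KA := AA S` (g0's table of the ORIGINAL state: vertices `m_d`, neighbours
`m_d + w_d i`, pure powers), `A := B + KA` (pointwise; `(x^A) = (x^B)·(x^KA)` by `span_image_add`); charts = the cones of the shifted state
with vertices `b_d + m_d ∈ A` and neighbours `b_d + (m_d + w_d i) ∈ A`; `hge` from `Good B` + ✓ `AA_ge`; the Rees cover `hcov` from
✓ `Inv.mw_int` for the SHIFTED state; `hθ/hg0` from `Good E` exactly as in ✓ `f108_pos`.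
★ `MonomialFloorClassRow.F108ConsumableRel_holds : ∀ k n, F108ConsumableRel k n`.  Consequently ✓ `monomialFloorCured_of_F108ConsumableRel`,
✓ `brieskornPham_monomialFloorCured_of_F108ConsumableRel` and ✓ p686042 `autMonomialFloorCured_of_F108ConsumableRel` hold with
`hF := F108ConsumableRel_holds k n`.  Sorry-free, standard axioms, no Literature fact.  AI-written; weaker than expert review.
Resolution of singularities in positive characteristic is NOT proved by any of this; no census row of a specific bed is asserted here.
-/

set_option linter.dupNamespace false

noncomputable section

namespace Summit.ResolutionOfSingularities.ResolutionOfSingularities.Theorems.FInjectiveMacaulayfication.F108Toric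

open Matrix Finset MvPolynomial Pointwise

variable {n : ℕ} {k : Type} [Field k]

/-! ## The relative assembly -/

/-- The case `n = 0` of `F108ConsumableRel`: empty tables, no chart. -/
theorem f108rel_zero (f : MvPolynomial (Fin 0) k) (B : Finset (Fin 0 →₀ ℕ)) :
    ∃ (A KA : Finset (Fin 0 →₀ ℕ)) (t : ℕ) (m : Fin t → (Fin 0 →₀ ℕ)) (V : Fin t → Matrix (Fin 0) (Fin 0) ℕ)
      (a : Fin t → Fin 0 → (Fin 0 →₀ ℕ)) (g : Fin t → MvPolynomial (Fin 0) k) (d : Fin t → (Fin 0 →₀ ℕ)),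
      Ideal.span ((fun e : Fin 0 →₀ ℕ => (monomial e (1 : k) : MvPolynomial (Fin 0) k)) '' (A : Set (Fin 0 →₀ ℕ))) =
        Ideal.span ((fun e : Fin 0 →₀ ℕ => (monomial e (1 : k) : MvPolynomial (Fin 0) k)) '' (B : Set (Fin 0 →₀ ℕ))) *
          Ideal.span ((fun e : Fin 0 →₀ ℕ => (monomial e (1 : k) : MvPolynomial (Fin 0) k)) '' (KA : Set (Fin 0 →₀ ℕ))) ∧
      (∀ j : Fin 0, ∃ N : ℕ, Finsupp.single j N ∈ KA) ∧
      (∀ j ∈ (Finset.univ : Finset (Fin 0)), ∃ N : ℕ, Finsupp.single j N ∈ A) ∧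
      (∀ e ∈ A, ∃ j ∈ (Finset.univ : Finset (Fin 0)), 0 < e j) ∧
      (∀ e ∈ A, ∃ (c : Fin t) (K : ℕ), 1 ≤ K ∧ ∃ y ∈ (Ideal.span ((fun b : Fin 0 →₀ ℕ => (monomial b (1 : k) : MvPolynomial (Fin 0) k)) '' (A : Set (Fin 0 →₀ ℕ)))) ^ (K - 1),
        (monomial e (1 : k) : MvPolynomial (Fin 0) k) ^ K = monomial (m c) 1 * y) ∧
      (∀ c, IsUnit ((V c).map (Nat.cast : ℕ → ℤ)).det) ∧
      (∀ c i, a c i ∈ A) ∧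
      (∀ (c : Fin t) (i : Fin 0), (Finsupp.equivFunOnFinite.symm ((V c).mulVec ⇑(a c i)) : Fin 0 →₀ ℕ) =
        Finsupp.equivFunOnFinite.symm ((V c).mulVec ⇑(m c)) + Finsupp.single i 1) ∧
      (∀ (c : Fin t), ∀ e ∈ A, (Finsupp.equivFunOnFinite.symm ((V c).mulVec ⇑(m c)) : Fin 0 →₀ ℕ) ≤ Finsupp.equivFunOnFinite.symm ((V c).mulVec ⇑e)) ∧
      (∀ c, aeval (fun j : Fin 0 => ∏ i : Fin 0, (X i : MvPolynomial (Fin 0) k) ^ V c i j) f = monomial (d c) 1 * g c) ∧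
      (∀ c, constantCoeff (g c) ≠ 0) ∧
      (∀ c, m c ∈ A) := by
  refine ⟨∅, ∅, 0, Fin.elim0, Fin.elim0, Fin.elim0, Fin.elim0, Fin.elim0, ?_, fun j => j.elim0, fun j => j.elim0, by simp, by simp,
    fun c => c.elim0, fun c => c.elim0, fun c => c.elim0, fun c => c.elim0, fun c => c.elim0, fun c => c.elim0, fun c => c.elim0⟩
  simp

/-- ★ THE MAIN CASE `n ≥ 1` of `F108ConsumableRel`: tables `A = B + AA S`, `KA = AA S`, charts = the cones of the `B`-shifted state. -/
theorem f108rel_pos (hn : 0 < n) (f : MvPolynomial (Fin n) k)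
    (hconv : ∀ j : Fin n, ∃ N : ℕ, 0 < N ∧ MvPolynomial.coeff (Finsupp.single j N) f ≠ 0)
    (B : Finset (Fin n →₀ ℕ)) (hB : ∀ j : Fin n, ∃ N : ℕ, 0 < N ∧ Finsupp.single j N ∈ B) :
    ∃ (A KA : Finset (Fin n →₀ ℕ)) (t : ℕ) (m : Fin t → (Fin n →₀ ℕ)) (V : Fin t → Matrix (Fin n) (Fin n) ℕ)
      (a : Fin t → Fin n → (Fin n →₀ ℕ)) (g : Fin t → MvPolynomial (Fin n) k) (d : Fin t → (Fin n →₀ ℕ)),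
      Ideal.span ((fun e : Fin n →₀ ℕ => (monomial e (1 : k) : MvPolynomial (Fin n) k)) '' (A : Set (Fin n →₀ ℕ))) =
        Ideal.span ((fun e : Fin n →₀ ℕ => (monomial e (1 : k) : MvPolynomial (Fin n) k)) '' (B : Set (Fin n →₀ ℕ))) *
          Ideal.span ((fun e : Fin n →₀ ℕ => (monomial e (1 : k) : MvPolynomial (Fin n) k)) '' (KA : Set (Fin n →₀ ℕ))) ∧
      (∀ j : Fin n, ∃ N : ℕ, Finsupp.single j N ∈ KA) ∧
      (∀ j ∈ (Finset.univ : Finset (Fin n)), ∃ N : ℕ, Finsupp.single j N ∈ A) ∧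
      (∀ e ∈ A, ∃ j ∈ (Finset.univ : Finset (Fin n)), 0 < e j) ∧
      (∀ e ∈ A, ∃ (c : Fin t) (K : ℕ), 1 ≤ K ∧ ∃ y ∈ (Ideal.span ((fun b : Fin n →₀ ℕ => (monomial b (1 : k) : MvPolynomial (Fin n) k)) '' (A : Set (Fin n →₀ ℕ)))) ^ (K - 1),
        (monomial e (1 : k) : MvPolynomial (Fin n) k) ^ K = monomial (m c) 1 * y) ∧
      (∀ c, IsUnit ((V c).map (Nat.cast : ℕ → ℤ)).det) ∧
      (∀ c i, a c i ∈ A) ∧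
      (∀ (c : Fin t) (i : Fin n), (Finsupp.equivFunOnFinite.symm ((V c).mulVec ⇑(a c i)) : Fin n →₀ ℕ) =
        Finsupp.equivFunOnFinite.symm ((V c).mulVec ⇑(m c)) + Finsupp.single i 1) ∧
      (∀ (c : Fin t), ∀ e ∈ A, (Finsupp.equivFunOnFinite.symm ((V c).mulVec ⇑(m c)) : Fin n →₀ ℕ) ≤ Finsupp.equivFunOnFinite.symm ((V c).mulVec ⇑e)) ∧
      (∀ c, aeval (fun j : Fin n => ∏ i : Fin n, (X i : MvPolynomial (Fin n) k) ^ V c i j) f = monomial (d c) 1 * g c) ∧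
      (∀ c, constantCoeff (g c) ≠ 0) ∧
      (∀ c, m c ∈ A) := by
  classical
  -- the exponent sets `E = supp f`, `Bz = B` in `ℤⁿ` and their sum
  set E : Finset (Fin n → ℤ) := f.support.image ofN with hE
  set Bz : Finset (Fin n → ℤ) := B.image ofN with hBz
  have hEnn : ∀ e ∈ E, ∀ j, 0 ≤ e j := by
    intro e he j; obtain ⟨e', -, rfl⟩ := mem_image.1 he; exact ofN_nonneg e' j
  have hBnn : ∀ b ∈ Bz, ∀ j, 0 ≤ b j := by
    intro b hb j; obtain ⟨b', -, rfl⟩ := mem_image.1 hb; exact ofN_nonneg b' j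
  have hEBnn : ∀ x ∈ (E + Bz), ∀ j, 0 ≤ x j := by
    intro x hx j; obtain ⟨e, he, b, hb, rfl⟩ := Finset.mem_add.1 hx; exact add_nonneg (hEnn e he j) (hBnn b hb j)
  have hEpp : ∀ l : Fin n, ∃ c : ℤ, 0 < c ∧ c • (Pi.single l 1 : Fin n → ℤ) ∈ E := by
    intro l; obtain ⟨N, hN, hcoeff⟩ := hconv l
    exact ⟨N, by exact_mod_cast hN, mem_image.2 ⟨Finsupp.single l N, mem_support_iff.2 hcoeff, ofN_single l N⟩⟩
  have hBpp : ∀ l : Fin n, ∃ c : ℤ, 0 < c ∧ c • (Pi.single l 1 : Fin n → ℤ) ∈ Bz := by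
    intro l; obtain ⟨N, hN, hmem⟩ := hB l
    exact ⟨N, by exact_mod_cast hN, mem_image.2 ⟨Finsupp.single l N, hmem, ofN_single l N⟩⟩
  have hEBconv : ∀ l : Fin n, ∃ c : ℤ, 0 < c ∧ c • (Pi.single l 1 : Fin n → ℤ) ∈ (E + Bz) := by
    intro l; obtain ⟨c, hc, hcE⟩ := hEpp l; obtain ⟨c', hc', hcB⟩ := hBpp l
    exact ⟨c + c', by omega, by rw [add_smul]; exact Finset.add_mem_add hcE hcB⟩
  -- the good state for `E + B`, good for `E` and for `B`
  obtain ⟨S, hS, hgood⟩ := exists_inv_good_convenient hn ((E + Bz)) hEBnn hEBconv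
  have hgoodE : ∀ d ∈ S, Good E d := fun d hd => good_left_of_add (hgood d hd)
  have hgoodB : ∀ d ∈ S, Good Bz d := fun d hd => good_right_of_add (hgood d hd)
  -- the `B`-minimiser of every cone, as a function of the rays
  have hβex : ∀ r : Fin n → Fin n → ℤ, ∃ b : Fin n → ℤ, (∃ d ∈ S, d.ray = r) →
      b ∈ Bz ∧ ∀ i, ∀ b' ∈ Bz, r i ⬝ᵥ b ≤ r i ⬝ᵥ b' := by
    intro r
    by_cases h : ∃ d ∈ S, d.ray = r
    · obtain ⟨d, hd, rfl⟩ := h; obtain ⟨b, hb, hmin⟩ := hgoodB d hd; exact ⟨b, fun _ => ⟨hb, hmin⟩⟩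
    · exact ⟨0, fun h' => absurd h' h⟩
  choose β hβ using hβex
  have hβS : ∀ d ∈ S, β d.ray ∈ Bz ∧ ∀ i, ∀ b' ∈ Bz, d.ray i ⬝ᵥ β d.ray ≤ d.ray i ⬝ᵥ b' :=
    fun d hd => hβ d.ray ⟨d, hd, rfl⟩
  -- the shifted state (vertices `b_d + m_d`) is a state
  set SB : Finset (DCone n) := S.image (fun d : DCone n => (⟨d.ray, β d.ray + d.m, d.w, d.l⟩ : DCone n)) with hSBdef
  have hSB : Inv SB := inv_image_shift hS β Bz hBnn (fun j => by obtain ⟨c, -, hc⟩ := hBpp j; exact ⟨c, hc⟩) hβS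
  have hgoodE' : ∀ d' ∈ SB, Good E d' := by
    intro d' hd'; obtain ⟨d, hd, rfl⟩ := mem_image_shift.1 hd'; exact good_shift (hgoodE d hd)
  -- the tables: `KA = AA S`, `A = B + KA`
  set KAf : Finset (Fin n →₀ ℕ) := (AA S).image toN with hKAf
  set Af : Finset (Fin n →₀ ℕ) := (B ×ˢ KAf).image fun p => p.1 + p.2 with hAf
  have mem_Af : ∀ x, x ∈ Af ↔ ∃ b ∈ B, ∃ κ ∈ KAf, x = b + κ := by
    intro x
    simp only [hAf, mem_image, mem_product, Prod.exists]
    constructor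
    · rintro ⟨b, κ, ⟨hb, hκ⟩, rfl⟩; exact ⟨b, hb, κ, hκ, rfl⟩
    · rintro ⟨b, hb, κ, hκ, rfl⟩; exact ⟨b, κ, ⟨hb, hκ⟩, rfl⟩
  -- the vertices and neighbours of the shifted state lie in `A`
  have hβB : ∀ d ∈ S, ∃ b₀ ∈ B, ofN b₀ = β d.ray := fun d hd => mem_image.1 (hβS d hd).1
  have hmAf : ∀ d' ∈ SB, toN d'.m ∈ Af := by
    intro d' hd'; obtain ⟨d, hd, rfl⟩ := mem_image_shift.1 hd'
    obtain ⟨b₀, hb₀, hb₀eq⟩ := hβB d hd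
    refine (mem_Af _).2 ⟨b₀, hb₀, toN d.m, mem_image_of_mem _ (m_mem_AA hd), ?_⟩
    dsimp only; rw [toN_add (hBnn _ (hβS d hd).1) (hS.mnonneg d hd), ← hb₀eq, toN_ofN]
  have haAf : ∀ d' ∈ SB, ∀ i, toN (d'.m + d'.w i) ∈ Af := by
    intro d' hd' i; obtain ⟨d, hd, rfl⟩ := mem_image_shift.1 hd'
    obtain ⟨b₀, hb₀, hb₀eq⟩ := hβB d hd
    refine (mem_Af _).2 ⟨b₀, hb₀, toN (d.m + d.w i), mem_image_of_mem _ (hS.m_add_w_mem_AA hd i), ?_⟩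
    dsimp only; rw [add_assoc, toN_add (x := β d.ray) (y := d.m + d.w i) (hBnn _ (hβS d hd).1)
      (fun j => hS.m_add_w_nonneg hd i j), ← hb₀eq, toN_ofN]
  -- every element of `A` dominates every shifted vertex on its cone
  have hgeSB : ∀ d' ∈ SB, ∀ i, ∀ b ∈ B, ∀ κ ∈ AA S, d'.ray i ⬝ᵥ d'.m ≤ d'.ray i ⬝ᵥ (ofN b + κ) := by
    intro d' hd' i b hb κ hκ; obtain ⟨d, hd, rfl⟩ := mem_image_shift.1 hd'
    dsimp only; rw [dotProduct_add, dotProduct_add]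
    exact add_le_add ((hβS d hd).2 i (ofN b) (mem_image_of_mem _ hb)) (hS.AA_ge hκ hd i)
  -- enumeration of the charts
  set enum : Fin SB.card → DCone n := fun c => (SB.equivFin.symm c).1 with henum
  have henumS : ∀ c, enum c ∈ SB := fun c => (SB.equivFin.symm c).2
  have hnn : ∀ c i j, 0 ≤ (enum c).ray i j := fun c => hSB.nonneg _ (henumS c)
  -- common minimisers in `supp f`
  have hmin0 : ∀ c, ∃ e₀ ∈ f.support, ∀ i, ∀ e ∈ f.support, (enum c).ray i ⬝ᵥ ofN e₀ ≤ (enum c).ray i ⬝ᵥ ofN e := by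
    intro c; obtain ⟨b, hb, hmin⟩ := hgoodE' _ (henumS c)
    obtain ⟨e₀, he₀, rfl⟩ := mem_image.1 hb
    exact ⟨e₀, he₀, fun i e he => hmin i (ofN e) (mem_image_of_mem _ he)⟩
  choose e₀ he₀ hmin using hmin0
  have hle : ∀ c, ∀ e ∈ f.support, (Finsupp.equivFunOnFinite.symm (natMat (enum c) *ᵥ ⇑(e₀ c)) : Fin n →₀ ℕ) ≤
      Finsupp.equivFunOnFinite.symm (natMat (enum c) *ᵥ ⇑e) := by
    intro c e he
    refine Finsupp.le_def.2 fun i => ?_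
    simp only [Finsupp.coe_equivFunOnFinite_symm]
    have h := hmin c i e he
    rw [← cast_natMat_mulVec_ofN (hnn c), ← cast_natMat_mulVec_ofN (hnn c)] at h
    exact_mod_cast h
  -- the data
  refine ⟨Af, KAf, SB.card, fun c => toN (enum c).m, fun c => natMat (enum c), fun c i => toN ((enum c).m + (enum c).w i),
    fun c => ∑ e ∈ f.support, monomial (Finsupp.equivFunOnFinite.symm (natMat (enum c) *ᵥ ⇑e) -
      Finsupp.equivFunOnFinite.symm (natMat (enum c) *ᵥ ⇑(e₀ c))) (coeff e f),
    fun c => Finsupp.equivFunOnFinite.symm (natMat (enum c) *ᵥ ⇑(e₀ c)), ?_, ?_, ?_, ?_, ?_, ?_, ?_, ?_, ?_, ?_, ?_, ?_⟩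
  · -- hIA
    have hAset : (Af : Set (Fin n →₀ ℕ)) = {e | ∃ b ∈ (B : Set (Fin n →₀ ℕ)), ∃ κ ∈ (KAf : Set (Fin n →₀ ℕ)), e = b + κ} := by
      ext e; simp only [mem_coe, Set.mem_setOf_eq]; exact mem_Af e
    rw [hAset]; exact span_image_add _ _
  · -- hKprim
    intro j
    refine ⟨(1 + bigN S).toNat, mem_image.2 ⟨_, succ_single_mem_AA j, ?_⟩⟩
    rw [show (Pi.single j 1 : Fin n → ℤ) + bigN S • Pi.single j 1 = (1 + bigN S) • Pi.single j 1 by rw [add_smul, one_smul],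
      toN_smul_single]
  · -- hprim
    intro j _
    obtain ⟨N, -, hN⟩ := hB j
    refine ⟨N + (1 + bigN S).toNat, (mem_Af _).2 ⟨Finsupp.single j N, hN, Finsupp.single j (1 + bigN S).toNat,
      mem_image.2 ⟨_, succ_single_mem_AA j, ?_⟩, by rw [Finsupp.single_add]⟩⟩
    rw [show (Pi.single j 1 : Fin n → ℤ) + bigN S • Pi.single j 1 = (1 + bigN S) • Pi.single j 1 by rw [add_smul, one_smul],
      toN_smul_single]
  · -- hAJ
    intro e he
    obtain ⟨b, -, κ, hκ, rfl⟩ := (mem_Af e).1 he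
    obtain ⟨κ', hκ', rfl⟩ := mem_image.1 hκ
    obtain ⟨j, hj⟩ := hS.AA_exists_pos hκ'
    refine ⟨j, mem_univ j, ?_⟩
    rw [Finsupp.add_apply, toN_apply]; omega
  · -- hcov
    intro e he
    obtain ⟨b, hb, κ, hκ, rfl⟩ := (mem_Af _).1 he
    obtain ⟨κ', hκ', rfl⟩ := mem_image.1 hκ
    have hκ'nn : ∀ j, 0 ≤ κ' j := hS.AA_nonneg hκ'
    -- the integral point `u = b + κ'` of the polyhedron of the shifted state
    set u : Fin n → ℤ := ofN b + κ' with hu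
    have hunn : ∀ j, 0 ≤ u j := fun j => add_nonneg (ofN_nonneg b j) (hκ'nn j)
    have heu : b + toN κ' = toN u := by rw [hu, toN_add (ofN_nonneg b) hκ'nn, toN_ofN]
    obtain ⟨D, μ, hD, hsum, hineq⟩ := hSB.mw_int u fun d' hd' i => hgeSB d' hd' i b hb κ' hκ'
    have hex : ∃ d₀ ∈ SB, 1 ≤ μ d₀ := by
      by_contra hno
      have h0 : ∀ d ∈ SB, μ d = 0 := fun d hd => by
        by_contra hne; exact hno ⟨d, hd, Nat.one_le_iff_ne_zero.2 hne⟩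
      rw [sum_eq_zero h0] at hsum
      omega
    obtain ⟨d₀, hd₀, hμ₀⟩ := hex
    set I := Ideal.span ((fun b : Fin n →₀ ℕ => (monomial b (1 : k) : MvPolynomial (Fin n) k)) '' ((Af : Finset _) : Set (Fin n →₀ ℕ))) with hI
    have hmemI : ∀ x ∈ SB, (monomial (toN x.m) (1 : k) : MvPolynomial (Fin n) k) ∈ I :=
      fun x hx => Ideal.subset_span ⟨toN x.m, mem_coe.2 (hmAf x hx), rfl⟩
    -- the remainder
    set r : Fin n → ℤ := fun j => (D : ℤ) * u j - ∑ d ∈ SB, (μ d : ℤ) * d.m j with hr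
    have hrnn : ∀ j, 0 ≤ r j := fun j => by rw [hr]; dsimp only; linarith [hineq j]
    refine ⟨SB.equivFin ⟨d₀, hd₀⟩, D + 1, by omega, ?_⟩
    have henum0 : enum (SB.equivFin ⟨d₀, hd₀⟩) = d₀ := by rw [henum]; simp
    simp only [henum0, Nat.add_sub_cancel]
    rw [heu]
    refine ⟨monomial (toN r) 1 * (monomial (toN u) 1 * (monomial (toN d₀.m) 1 ^ (μ d₀ - 1) *
      ∏ d ∈ SB.erase d₀, monomial (toN d.m) 1 ^ μ d)), ?_, ?_⟩
    · -- membership in `I ^ D`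
      refine Ideal.mul_mem_left _ _ ?_
      have h1 : (monomial (toN u) (1 : k) : MvPolynomial (Fin n) k) ∈ I ^ 1 := by
        rw [pow_one]; exact Ideal.subset_span ⟨toN u, mem_coe.2 (heu ▸ he), rfl⟩
      have h2 : (monomial (toN d₀.m) (1 : k) : MvPolynomial (Fin n) k) ^ (μ d₀ - 1) ∈ I ^ (μ d₀ - 1) :=
        Ideal.pow_mem_pow (hmemI _ hd₀) _
      have h3 : ∏ d ∈ SB.erase d₀, (monomial (toN d.m) (1 : k) : MvPolynomial (Fin n) k) ^ μ d ∈ I ^ (∑ d ∈ SB.erase d₀, μ d) := by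
        rw [← prod_pow_eq_pow_sum]
        exact Ideal.prod_mem_prod fun d hd => Ideal.pow_mem_pow (hmemI _ (mem_of_mem_erase hd)) _
      have hD' : 1 + (μ d₀ - 1) + ∑ d ∈ SB.erase d₀, μ d = D := by
        rw [← hsum, ← add_sum_erase SB μ hd₀]; omega
      rw [← hD', pow_add, pow_add, mul_assoc]
      exact Ideal.mul_mem_mul h1 (Ideal.mul_mem_mul h2 h3)
    · -- the exponent identity
      have hmnn : ∀ d ∈ SB, ∀ j, 0 ≤ d.m j := fun d hd => hSB.mnonneg d hd
      simp_rw [monomial_pow, one_pow]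
      rw [prod_monomial_one]
      simp only [monomial_mul, one_mul]
      congr 1
      congr 1
      apply Finsupp.ext; intro j
      have hsumS : ∑ d ∈ SB, (μ d : ℤ) * d.m j = (μ d₀ : ℤ) * d₀.m j + ∑ d ∈ SB.erase d₀, (μ d : ℤ) * d.m j :=
        (add_sum_erase SB (fun d => (μ d : ℤ) * d.m j) hd₀).symm
      simp only [Finsupp.coe_add, Pi.add_apply, Finsupp.coe_smul, Pi.smul_apply, smul_eq_mul, Finsupp.finsetSum_apply]
      zify [hμ₀]
      rw [cast_toN hunn, cast_toN (hmnn d₀ hd₀), cast_toN hrnn]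
      rw [sum_congr rfl fun d hd => by rw [cast_toN (hmnn d (mem_of_mem_erase hd))]]
      rw [hr]; dsimp only; rw [hsumS]; ring
  · -- hV
    intro c; rw [natMat_map_cast (hnn c)]; exact hSB.isUnit_det (henumS c)
  · -- haA
    intro c i; exact haAf _ (henumS c) i
  · -- hgen
    intro c i
    apply Finsupp.ext; intro j
    simp only [Finsupp.coe_equivFunOnFinite_symm, Finsupp.coe_add, Pi.add_apply]
    have h := hSB.ray_dot_m_add_w (henumS c) i j
    rw [← cast_natMat_mulVec_toN (hnn c) (x := (enum c).m + (enum c).w i) (fun j => hSB.m_add_w_nonneg (henumS c) i j),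
      ← cast_natMat_mulVec_toN (hnn c) (x := (enum c).m) (hSB.mnonneg _ (henumS c))] at h
    rw [Finsupp.single_apply]
    by_cases hij : i = j
    · subst hij; rw [if_pos rfl] at h ⊢; exact_mod_cast h
    · rw [if_neg hij] at h ⊢; exact_mod_cast h
  · -- hge
    intro c e he
    obtain ⟨b, hb, κ, hκ, rfl⟩ := (mem_Af _).1 he
    obtain ⟨κ', hκ', rfl⟩ := mem_image.1 hκ
    have heu : b + toN κ' = toN (ofN b + κ') := by rw [toN_add (ofN_nonneg b) (hS.AA_nonneg hκ'), toN_ofN]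
    rw [heu]
    refine Finsupp.le_def.2 fun i => ?_
    simp only [Finsupp.coe_equivFunOnFinite_symm]
    have h := hgeSB _ (henumS c) i b hb κ' hκ'
    rw [← cast_natMat_mulVec_toN (hnn c) (hSB.mnonneg _ (henumS c)),
      ← cast_natMat_mulVec_toN (hnn c) (x := ofN b + κ') (fun j => add_nonneg (ofN_nonneg b j) (hS.AA_nonneg hκ' j))] at h
    exact_mod_cast h
  · -- hθ
    intro c
    conv_lhs => rw [f.as_sum]
    rw [map_sum, mul_sum]
    refine sum_congr rfl fun e he => ?_
    rw [aeval_monomial_natMat, monomial_mul, one_mul, add_tsub_cancel_of_le (hle c e he)]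
  · -- hg0
    intro c
    rw [map_sum]
    simp_rw [constantCoeff_monomial]
    rw [sum_eq_single (e₀ c)]
    · rw [if_pos (tsub_self _)]; exact mem_support_iff.1 (he₀ c)
    · intro e he hne
      rw [if_neg]
      intro h0
      apply hne
      have hle' := hle c e he
      have hge' : (Finsupp.equivFunOnFinite.symm (natMat (enum c) *ᵥ ⇑e) : Fin n →₀ ℕ) ≤
          Finsupp.equivFunOnFinite.symm (natMat (enum c) *ᵥ ⇑(e₀ c)) := tsub_eq_zero_iff_le.1 h0
      have heq : natMat (enum c) *ᵥ ⇑e = natMat (enum c) *ᵥ ⇑(e₀ c) := by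
        have := le_antisymm hge' hle'
        funext i; have := congrArg (fun v => v i) this; simpa using this
      -- the ray matrix is injective
      have hz : (Matrix.of (enum c).ray) *ᵥ ofN e = (Matrix.of (enum c).ray) *ᵥ ofN (e₀ c) := by
        funext i
        have h1 := cast_natMat_mulVec_ofN (hnn c) e i
        have h2 := cast_natMat_mulVec_ofN (hnn c) (e₀ c) i
        rw [heq] at h1
        have h3 : (enum c).ray i ⬝ᵥ ofN e = (enum c).ray i ⬝ᵥ ofN (e₀ c) := h1.symm.trans h2
        exact h3
      have := hSB.mulVec_injective (henumS c) hz
      ext i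
      have h4 : ((e i : ℕ) : ℤ) = ((e₀ c i : ℕ) : ℤ) := congrFun this i
      exact_mod_cast h4
    · intro h; exact absurd (he₀ c) h
  · -- hm
    intro c; exact hmAf _ (henumS c)

end Summit.ResolutionOfSingularities.ResolutionOfSingularities.Theorems.FInjectiveMacaulayfication.F108Toric

namespace Summit.ResolutionOfSingularities.ResolutionOfSingularities.Theorems.FInjectiveMacaulayfication.MonomialFloorClassRow

/-- ★★★ **`F108ConsumableRel k n` HOLDS for every field `k` and every `n`** (toric resolution of the Newton fan of a convenient polynomial
RELATIVE TO AN ARBITRARY `𝔪`-primary monomial floor `(x^B)`, in the fan-table currency of ✓ p685336 §2 `fHalfRowRel_of_tables`): the OURS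
open-obligation node of `…MonomialFloorClassRow` is discharged in the kernel, so `monomialFloorCured_of_F108ConsumableRel`,
`brieskornPham_monomialFloorCured_of_F108ConsumableRel` and ✓ p686042 `autMonomialFloorCured_of_F108ConsumableRel` hold with
`hF := F108ConsumableRel_holds k n`. [OURS · kernel theorem; no Literature fact used] -/
theorem F108ConsumableRel_holds (k : Type) [Field k] (n : ℕ) : F108ConsumableRel k n := by
  intro f hconv B hB
  rcases Nat.eq_zero_or_pos n with hn | hn
  · subst hn; exact F108Toric.f108rel_zero f B
  · exact F108Toric.f108rel_pos hn f hconv B hB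

end Summit.ResolutionOfSingularities.ResolutionOfSingularities.Theorems.FInjectiveMacaulayfication.MonomialFloorClassRow

end
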